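import Literature.NumberTheory.LFunctions.Xiao2020.KeiperLiTaylor
import Literature.Analysis.SpecialFunctions.DigammaStirlingSeries
import Mathlib.Analysis.Complex.Liouville
import Mathlib.NumberTheory.Harmonic.EulerMascheroni
import HarnessLib

/-!
# RH-FREE: the trend of the Keiper–Li coefficients — `λ_n − S_n = (n/2)(H_n − 1 − log 2π) + 1/2 + O(1)`

Topic `Literature/NumberTheory/LFunctions` (siblings: `RiemannXi.lean` — the Keiper–Li coefficients
`λ_n = keiperLiCoeff n`; `Xiao2020/KeiperLiTaylor.lean` — the Taylor coefficients
`q_j = (ζ₁'/ζ₁)^{(j)}(1)/j!` (`zetaOneLogDerivCoeff`), `ζ₁(s) = (s−1)ζ(s)`; `LiCriterion.lean` — Li's map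
`m(z) = 1/(1−z)` and the change of variables `dⁿ/dsⁿ[s^{n−1}G](1) = dⁿ/dzⁿ[G ∘ m](0)`).
Everything here is PROVED; there are no definitions and no named facts.  **RH-FREE**: no hypothesis
on the zeros of `ζ` enters anywhere.

## The decomposition `λ_n = S̄_n + S_n` (Bombieri–Lagarias 1999, Thm. 2; Voros 2006, §4)

Substituting `ξ(s) = (s/2) Γℝ(s) ζ₁(s)` into `λ_n = (1/(n−1)!) dⁿ/dsⁿ[s^{n−1} log ξ(s)]_{s=1}` splits
`λ_n = S_n + S̄_n`, where

* `S_n = (1/(n−1)!) dⁿ/dsⁿ[s^{n−1} log ζ₁(s)]_{s=1} = Σ_{j<n} C(n,j+1) Re q_j = −Σ_{j=1}^{n} C(n,j) η_{j−1}`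
  (`η_j = −q_j` are Bombieri–Lagarias' coefficients of `−ζ'/ζ(s) = 1/(s−1) + Σ η_j (s−1)^j`) is the
  OSCILLATING ("arithmetic") part, the contribution of `(s−1)ζ(s)` (`keiperLiOsc_eq_iteratedDeriv`);
* `S̄_n = λ_n − S_n`, the TREND ("archimedean part"), is the contribution of the Gamma factor
  `(s/2)Γℝ(s) = π^{−s/2} Γ(1 + s/2)`.

## Results

* `keiperLiCoeff_sub_osc_eq_finite_sum` — Bombieri–Lagarias' finite form
  `S̄_n = 1 − (n/2)(γ + log π + 2 log 2) + Σ_{j=2}^{n} (−1)ʲ C(n,j)(1 − 2^{−j}) ζ(j)`;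
* `abs_keiperLiCoeff_sub_osc_sub_trend_le` — **the trend law**, uniform in `n ≥ 1`:
  `|S̄_n − ((n/2)(H_n − 1 − log 2π) + 1/2)| ≤ 2/π` (`H_n` the harmonic number);
* `keiperLiTrend_log_bounds` — hence `S̄_n = (n/2)(log n + γ − 1 − log 2π) + θ_n`, `θ_n ∈ [1/2 − 2/π, 1 + 2/π]`,
  Maślanka's empirical trend `½ n log n + c n`, `c = ½(γ − 1 − log 2π)`, with explicit constants;
* `abs_keiperLiCoeff_sub_osc_sub_trend_le_div` — decay of the error: `|S̄_n − ((n/2)(H_n − 1 − log 2π) + 1/2)|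
  ≤ (640/π³)/(n−1)` for `n ≥ 2` (one more Stirling term, one derivative, Cauchy), whence
  `tendsto_keiperLiCoeff_sub_osc_sub_trend`: `S̄_n − (n/2)(H_n − 1 − log 2π) → 1/2`.

Voros (2006, (4.6)) proves the full asymptotic expansion `S̄_n ∼ ½n(log n − 1 + γ − log 2π) + 3/4 − Σ_k
B_{2k}/(4k) n^{1−2k}` by a Nörlund–Rice integral; in the variable `H_n` his main term is EXACTLY
`(n/2)(H_n − 1 − log 2π) + 1/2` and the error is `o(n^{−N})` for every `N`.  Here only `O(1)` with the
explicit constant `2/π` (and the decay `O(1/n)`, last section) is proved (`-- TODO(general form)` in the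
docstring of the main theorem), by a different and elementary route:

1. (`keiperLiCoeff_sub_osc_eq_iteratedDeriv`) Li's change of variables gives
   `S̄_n = Re 𝒜^{(n−1)}(0)/(n−1)!` for the generating function `𝒜 = (G ∘ m)′`,
   `G = log ξ − log ζ₁`, `G′ = 1/s + Γℝ′/Γℝ` (`logDeriv_riemannXi_eq`), i.e.
   `𝒜(z) = L + (−log π/2 + ψ(L/2)/2) L²`, `L = m(z)`, `ψ` the digamma function.
2. (`trendGen_eq_trendElem_add_trendRem`) Stirling: `ψ(w) = Log w − 1/(2w) − 1/(12w²) + R(w)` splits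
   `𝒜 = E + Φ`, `E = L/2 − 1/6 − (log π/2)L² + L² Log(L/2)/2`, `Φ = (L²/2) R(L/2)`.
3. (`iteratedDeriv_trendElem_zero`) `E^{(m)}(0)/m! = (m+1)/2 (H_{m+1} − 1 − log 2π) + 1/2 − [m=0]/6`
   (Leibniz; `m′ = m²`, `(Log(m/2))′ = m`).
4. (`norm_iteratedDeriv_trendRem_le`) `m` maps the unit disc onto `Re L > 1/2`, where the tree's explicit
   Stirling remainder (`norm_digamma_sub_stirlingSeries_le`, `ν = 1`) gives `|Φ| ≤ 1/(π Re L) < 2/π`;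
   Cauchy's estimate on `|z| = r → 1⁻` bounds `|Φ^{(m)}(0)| ≤ m!·2/π`.

## References

* E. Bombieri, J. C. Lagarias, *Complements to Li's criterion for the Riemann hypothesis*, J. Number
  Theory 77 (1999), 274–287, Thm. 2 (the arithmetic formula). [BombieriLagarias1999]
* A. Voros, *Sharpenings of Li's criterion for the Riemann hypothesis*, Math. Phys. Anal. Geom. 9
  (2006), 53–63, §4, eqs. (4.2)–(4.6) (held: `paper:arxiv-math_0506326`, p. 7). [Voros2006]
* K. Maślanka, *An explicit formula relating Stieltjes constants and Li's numbers*,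
  arXiv:math/0406312 (2004), §3–4 (the trend/oscillation split, empirical trend). 
* X.-J. Li, J. Number Theory 65 (1997), 325–333, (1.1), (1.4)–(1.5). [Li1997]
* G. E. Andrews, R. Askey, R. Roy, *Special Functions* (1999), Cor. 1.4.5 (Stirling for `ψ`).
  [AndrewsAskeyRoy1999]
-/

noncomputable section

open Complex Filter Topology Set Metric Finset
open scoped Nat

namespace Literature.NumberTheory.LFunctions

/-! ### The Li map `m(z) = 1/(1−z)` on the unit disc -/

/-- For `|z| < 1`, `z ≠ 1`. [folklore] -/
private theorem ne_one_of_norm_lt_one {z : ℂ} (hz : ‖z‖ < 1) : z ≠ 1 := fun h ↦ by simp [h] at hz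

/-- For `|z| < 1`, `Re (1/(1−z)) > 1/2`: the Li map sends the unit disc onto the half-plane
`Re s > 1/2`. [folklore] -/
private theorem one_half_lt_re_liMap {z : ℂ} (hz : ‖z‖ < 1) : 1 / 2 < (liMap z).re := by
  have hne : (1 - z) ≠ 0 := sub_ne_zero.2 (Ne.symm (ne_one_of_norm_lt_one hz))
  have hns : 0 < Complex.normSq (1 - z) := Complex.normSq_pos.2 hne
  rw [liMap, Complex.inv_re, lt_div_iff₀ hns]
  have h1 : Complex.normSq (1 - z) = (1 - z.re) ^ 2 + z.im ^ 2 := by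
    rw [Complex.normSq_apply]; simp; ring
  have h2 : z.re ^ 2 + z.im ^ 2 < 1 := by
    have h3 : Complex.normSq z < 1 := by
      rw [Complex.normSq_eq_norm_sq]; nlinarith [norm_nonneg z]
    rw [Complex.normSq_apply] at h3; nlinarith
  rw [h1]
  simp only [sub_re, one_re]
  nlinarith

/-- `m(z) ≠ 0`. [folklore] -/
private theorem liMap_ne_zero (z : ℂ) (hz : z ≠ 1) : liMap z ≠ 0 :=
  inv_ne_zero (sub_ne_zero.2 (Ne.symm hz))

/-- On the unit disc `m(z)/2` lies in the right half-plane. [folklore] -/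
private theorem re_liMap_half_pos {z : ℂ} (hz : ‖z‖ < 1) : 0 < (liMap z / 2).re := by
  have h := one_half_lt_re_liMap hz
  rw [Complex.div_ofNat_re]; linarith

/-- `dᵐ/dzᵐ [m(z)²](0) = (m+1)!` (`m² = m'`). [folklore] -/
private theorem iteratedDeriv_liMap_sq_zero (m : ℕ) :
    iteratedDeriv m (fun z ↦ liMap z ^ 2) 0 = ((m + 1)! : ℂ) := by
  have hev : (fun z ↦ liMap z ^ 2) =ᶠ[𝓝 (0 : ℂ)] deriv liMap := by
    filter_upwards [eventually_ne_nhds (zero_ne_one : (0 : ℂ) ≠ 1)] with z hz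
    exact (hasDerivAt_liMap hz).deriv.symm
  rw [hev.iteratedDeriv_eq, ← iteratedDeriv_succ', iteratedDeriv_liMap_zero]

/-- On the unit disc, `d/dz Log(m(z)/2) = m(z)`. [folklore] -/
private theorem hasDerivAt_log_liMap_half {z : ℂ} (hz : ‖z‖ < 1) :
    HasDerivAt (fun z ↦ Complex.log (liMap z / 2)) (liMap z) z := by
  have hz1 := ne_one_of_norm_lt_one hz
  have hsl : liMap z / 2 ∈ slitPlane := Complex.mem_slitPlane_iff.2 (Or.inl (re_liMap_half_pos hz))
  have h1 : HasDerivAt (fun z ↦ liMap z / 2) (liMap z ^ 2 / 2) z :=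
    (hasDerivAt_liMap hz1).div_const 2
  convert h1.clog hsl using 1
  have h0 := liMap_ne_zero z hz1
  field_simp

/-- `Log(m(·)/2)` is analytic on the unit disc. [folklore] -/
private theorem analyticAt_log_liMap_half {z : ℂ} (hz : ‖z‖ < 1) :
    AnalyticAt ℂ (fun z ↦ Complex.log (liMap z / 2)) z := by
  have hz1 := ne_one_of_norm_lt_one hz
  exact ((analyticAt_liMap hz1).div analyticAt_const two_ne_zero).clog
    (Complex.mem_slitPlane_iff.2 (Or.inl (re_liMap_half_pos hz)))

/-- `d^{i+1}/dz^{i+1} [Log(m(z)/2)](0) = i!`. [folklore] -/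
private theorem iteratedDeriv_succ_log_liMap_half_zero (i : ℕ) :
    iteratedDeriv (i + 1) (fun z ↦ Complex.log (liMap z / 2)) 0 = (i ! : ℂ) := by
  rw [iteratedDeriv_succ']
  have hev : deriv (fun z ↦ Complex.log (liMap z / 2)) =ᶠ[𝓝 (0 : ℂ)] liMap := by
    filter_upwards [Metric.ball_mem_nhds (0 : ℂ) one_pos] with z hz
    exact (hasDerivAt_log_liMap_half (by simpa using hz)).deriv
  rw [hev.iteratedDeriv_eq, iteratedDeriv_liMap_zero]

/-- Leibniz: `d^N/dz^N [(Log(m(z)/2) − 1) · m(z)](0) = N! (H_N − 1 − log 2)`, with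
`H_N = Σ_{i<N} 1/(i+1)` the harmonic number. [folklore] -/
private theorem iteratedDeriv_log_liMap_half_mul_zero (N : ℕ) :
    iteratedDeriv N (fun z ↦ (-1 + Complex.log (liMap z / 2)) * liMap z) 0 =
      (N ! : ℂ) * ((∑ i ∈ Finset.range N, ((i : ℂ) + 1)⁻¹) - 1 - Real.log 2) := by
  have hF : ContDiffAt ℂ N (fun z ↦ -1 + Complex.log (liMap z / 2)) 0 :=
    (analyticAt_const.add (analyticAt_log_liMap_half (by simp))).contDiffAt
  have hL : ContDiffAt ℂ N liMap 0 := (analyticAt_liMap zero_ne_one).contDiffAt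
  rw [iteratedDeriv_fun_mul hF hL, Finset.sum_range_succ']
  have hlog : Complex.log (1 / 2) = -Real.log 2 := by
    rw [show (1 / 2 : ℂ) = ((1 / 2 : ℝ) : ℂ) by push_cast; ring, ← Complex.ofReal_log (by norm_num),
      show (1 / 2 : ℝ) = 2⁻¹ by norm_num, Real.log_inv]
    push_cast; ring
  have h0 : iteratedDeriv 0 (fun z ↦ -1 + Complex.log (liMap z / 2)) 0 = -1 - Real.log 2 := by
    rw [iteratedDeriv_zero, liMap_zero, hlog]; ring
  have hS : ∀ i ∈ Finset.range N, (N.choose (i + 1) : ℂ) *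
      iteratedDeriv (i + 1) (fun z ↦ -1 + Complex.log (liMap z / 2)) 0 *
      iteratedDeriv (N - (i + 1)) liMap 0 = (N ! : ℂ) * ((i : ℂ) + 1)⁻¹ := by
    intro i hi
    have hi' : i + 1 ≤ N := Finset.mem_range.1 hi
    rw [iteratedDeriv_const_add (Nat.succ_pos i), iteratedDeriv_liMap_zero,
      iteratedDeriv_succ_log_liMap_half_zero]
    have hc := congrArg (Nat.cast : ℕ → ℂ) (Nat.choose_mul_factorial_mul_factorial hi')
    push_cast [Nat.factorial_succ] at hc
    have hi0 : ((i : ℂ) + 1) ≠ 0 := by exact_mod_cast Nat.succ_ne_zero i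
    field_simp
    linear_combination hc
  rw [Finset.sum_congr rfl hS, h0, ← Finset.mul_sum, Nat.choose_zero_right, Nat.sub_zero,
    iteratedDeriv_liMap_zero]
  push_cast
  ring

/-- **Taylor coefficients of `m(z)² Log(m(z)/2)`**: `dᵐ/dzᵐ [m² Log(m/2)](0) = (m+1)! (H_{m+1} − 1 − log 2)`
(`m² Log(m/2)` is the derivative of `(Log(m/2) − 1)·m`). [folklore] -/
private theorem iteratedDeriv_liMap_sq_mul_log_zero (m : ℕ) :
    iteratedDeriv m (fun z ↦ liMap z ^ 2 * Complex.log (liMap z / 2)) 0 =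
      ((m + 1)! : ℂ) * ((∑ i ∈ Finset.range (m + 1), ((i : ℂ) + 1)⁻¹) - 1 - Real.log 2) := by
  have hev : (fun z ↦ liMap z ^ 2 * Complex.log (liMap z / 2)) =ᶠ[𝓝 (0 : ℂ)]
      deriv (fun z ↦ (-1 + Complex.log (liMap z / 2)) * liMap z) := by
    filter_upwards [Metric.ball_mem_nhds (0 : ℂ) one_pos] with z hz
    have hz' : ‖z‖ < 1 := by simpa using hz
    have h1 := hasDerivAt_log_liMap_half hz'
    have h2 := hasDerivAt_liMap (ne_one_of_norm_lt_one hz')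
    have h3 : HasDerivAt (fun z ↦ (-1 + Complex.log (liMap z / 2)) * liMap z)
        (liMap z * liMap z + (-1 + Complex.log (liMap z / 2)) * liMap z ^ 2) z :=
      (h1.const_add (-1)).mul h2
    rw [h3.deriv]
    ring
  rw [hev.iteratedDeriv_eq, ← iteratedDeriv_succ', iteratedDeriv_log_liMap_half_mul_zero]

/-- The elementary part of the generating function: with `L = m(z)`,
`E(z) = L/2 − 1/6 − (log π/2) L² + L² Log(L/2)/2`; its Taylor coefficients are
`dᵐE/dzᵐ(0)/m! = (m+1)/2 · (H_{m+1} − 1 − log 2π) + 1/2 − [m = 0]/6`. [folklore] -/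
private theorem iteratedDeriv_trendElem_zero (m : ℕ) :
    iteratedDeriv m (fun z ↦ liMap z / 2 - 1 / 6 - (Real.log Real.pi : ℂ) / 2 * liMap z ^ 2 +
        liMap z ^ 2 * Complex.log (liMap z / 2) / 2) 0 =
      (m ! : ℂ) * (((m : ℂ) + 1) / 2 * ((∑ i ∈ Finset.range (m + 1), ((i : ℂ) + 1)⁻¹) - 1 -
        Real.log 2 - Real.log Real.pi) + 1 / 2 - if m = 0 then 1 / 6 else 0) := by
  have hA : AnalyticAt ℂ liMap 0 := analyticAt_liMap zero_ne_one
  have h1 : ContDiffAt ℂ m (fun z ↦ liMap z / 2) 0 := (hA.div analyticAt_const two_ne_zero).contDiffAt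
  have h2 : ContDiffAt ℂ m (fun _ : ℂ ↦ (1 / 6 : ℂ)) 0 := contDiffAt_const
  have h3 : ContDiffAt ℂ m (fun z ↦ (Real.log Real.pi : ℂ) / 2 * liMap z ^ 2) 0 :=
    (analyticAt_const.mul (hA.pow 2)).contDiffAt
  have h4 : ContDiffAt ℂ m (fun z ↦ liMap z ^ 2 * Complex.log (liMap z / 2) / 2) 0 :=
    (((hA.pow 2).mul (analyticAt_log_liMap_half (by simp))).div analyticAt_const
      two_ne_zero).contDiffAt
  rw [iteratedDeriv_fun_add ((h1.sub h2).sub h3) h4, iteratedDeriv_fun_sub (h1.sub h2) h3,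
    iteratedDeriv_fun_sub h1 h2, iteratedDeriv_div_const, iteratedDeriv_liMap_zero,
    iteratedDeriv_const, iteratedDeriv_const_mul_field ((Real.log Real.pi : ℂ) / 2) (fun z ↦ liMap z ^ 2),
    iteratedDeriv_liMap_sq_zero, iteratedDeriv_div_const, iteratedDeriv_liMap_sq_mul_log_zero]
  split_ifs with hm
  · subst hm; push_cast; ring
  · push_cast [Nat.factorial_succ]; ring

/-! ### The Stirling remainder part of the generating function and Cauchy's estimate -/

/-- Second-order Stirling for `ψ` on the right half-plane (the case `ν = 1` of
`norm_digamma_sub_stirlingSeries_le`): `‖ψ(w) − Log w + 1/(2w) + 1/(12w²)‖ ≤ 1/(4π‖w‖² Re w)`.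
[cite: AndrewsAskeyRoy1999, Cor 1.4.5] -/
theorem norm_digamma_sub_stirling_two_le {w : ℂ} (hw : 0 < w.re) :
    ‖Complex.digamma w - Complex.log w + 1 / (2 * w) + 1 / (12 * w ^ 2)‖ ≤
      1 / (4 * Real.pi) / (‖w‖ ^ 2 * w.re) := by
  have h := Literature.Analysis.SpecialFunctions.Complex.norm_digamma_sub_stirlingSeries_le hw
    one_ne_zero
  have hw0 : w ≠ 0 := fun h0 ↦ by rw [h0] at hw; simp at hw
  have hb : (bernoulli 2 : ℂ) = 1 / 6 := by
    rw [bernoulli_eq_bernoulli'_of_ne_one (by norm_num), bernoulli'_two]; push_cast; ring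
  simp only [Finset.Icc_self, Finset.sum_singleton, Nat.mul_one, hb] at h
  have heq : Complex.digamma w - (Complex.log w - 1 / (2 * w) - 1 / 6 / (2 * (1 : ℕ)) / w ^ 2) =
      Complex.digamma w - Complex.log w + 1 / (2 * w) + 1 / (12 * w ^ 2) := by
    push_cast; field_simp; ring
  rw [heq] at h
  refine h.trans (le_of_eq ?_)
  simp only [Nat.factorial, Nat.succ_eq_add_one]
  push_cast
  have hπ : Real.pi ≠ 0 := Real.pi_ne_zero
  field_simp
  ring

/-- The remainder part of the generating function, `Φ(z) = (L²/2)(ψ(L/2) − Log(L/2) + 1/L + 1/(3L²))`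
(`L = m(z)`), is bounded by `1/(π Re L)` on the unit disc. [folklore] -/
private theorem norm_trendRem_le {z : ℂ} (hz : ‖z‖ < 1) :
    ‖liMap z ^ 2 / 2 * (Complex.digamma (liMap z / 2) - Complex.log (liMap z / 2) + (liMap z)⁻¹ +
        (3 * liMap z ^ 2)⁻¹)‖ ≤ 1 / (Real.pi * (liMap z).re) := by
  have hw : 0 < (liMap z / 2).re := re_liMap_half_pos hz
  have hre : 0 < (liMap z).re := by linarith [one_half_lt_re_liMap hz]
  have h := norm_digamma_sub_stirling_two_le hw
  have hL0 : liMap z ≠ 0 := liMap_ne_zero z (ne_one_of_norm_lt_one hz)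
  have hLn : ‖liMap z‖ ≠ 0 := norm_ne_zero_iff.2 hL0
  have heq : Complex.digamma (liMap z / 2) - Complex.log (liMap z / 2) + (liMap z)⁻¹ +
      (3 * liMap z ^ 2)⁻¹ = Complex.digamma (liMap z / 2) - Complex.log (liMap z / 2) +
        1 / (2 * (liMap z / 2)) + 1 / (12 * (liMap z / 2) ^ 2) := by
    field_simp; ring
  rw [heq, norm_mul]
  calc ‖liMap z ^ 2 / 2‖ * ‖Complex.digamma (liMap z / 2) - Complex.log (liMap z / 2) +
        1 / (2 * (liMap z / 2)) + 1 / (12 * (liMap z / 2) ^ 2)‖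
      ≤ ‖liMap z ^ 2 / 2‖ * (1 / (4 * Real.pi) / (‖liMap z / 2‖ ^ 2 * (liMap z / 2).re)) := by
        gcongr
    _ = 1 / (Real.pi * (liMap z).re) := by
        rw [norm_div, norm_pow, Complex.div_ofNat_re, norm_div]
        simp only [RCLike.norm_ofNat]
        have hπ : Real.pi ≠ 0 := Real.pi_ne_zero
        field_simp
        ring

/-- The remainder part `Φ` is holomorphic on the unit disc. [folklore] -/
private theorem differentiableOn_trendRem :
    DifferentiableOn ℂ (fun z ↦ liMap z ^ 2 / 2 * (Complex.digamma (liMap z / 2) -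
      Complex.log (liMap z / 2) + (liMap z)⁻¹ + (3 * liMap z ^ 2)⁻¹)) (ball 0 1) := by
  intro z hz
  have hz' : ‖z‖ < 1 := by simpa using hz
  have hz1 := ne_one_of_norm_lt_one hz'
  have hL : DifferentiableAt ℂ liMap z := (hasDerivAt_liMap hz1).differentiableAt
  have hL0 := liMap_ne_zero z hz1
  have hw : 0 < (liMap z / 2).re := re_liMap_half_pos hz'
  have hψ : DifferentiableAt ℂ Complex.digamma (liMap z / 2) :=
    (Literature.Analysis.SpecialFunctions.Complex.differentiableOn_digamma _ hw).differentiableAt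
      ((isOpen_lt continuous_const Complex.continuous_re).mem_nhds hw)
  have hψ' : DifferentiableAt ℂ (fun z ↦ Complex.digamma (liMap z / 2)) z :=
    hψ.comp z (hL.div_const 2)
  have hlog : DifferentiableAt ℂ (fun z ↦ Complex.log (liMap z / 2)) z :=
    (hL.div_const 2).clog (Complex.mem_slitPlane_iff.2 (Or.inl hw))
  have h3 : DifferentiableAt ℂ (fun z ↦ (3 * liMap z ^ 2)⁻¹) z :=
    ((differentiableAt_const _).mul (hL.pow 2)).inv (mul_ne_zero three_ne_zero (pow_ne_zero 2 hL0))
  exact (((hL.pow 2).div_const 2).mul (((hψ'.sub hlog).add (hL.inv hL0)).add h3)).differentiableWithinAt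

/-- **Cauchy's estimate on the unit disc**: if `Φ` is holomorphic on `|z| < 1` with `‖Φ‖ ≤ M`
there, then `‖Φ⁽ᵐ⁾(0)‖ ≤ m! · M` (Cauchy's inequality on the circle `|z| = r`, `r → 1⁻`). [folklore] -/
private theorem norm_iteratedDeriv_le_of_forall_mem_unitBall {Φ : ℂ → ℂ} {M : ℝ}
    (hd : DifferentiableOn ℂ Φ (ball 0 1)) (hM : ∀ z ∈ ball (0 : ℂ) 1, ‖Φ z‖ ≤ M) (m : ℕ) :
    ‖iteratedDeriv m Φ 0‖ ≤ m ! * M := by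
  have key : ∀ r : ℝ, 0 < r → r < 1 → ‖iteratedDeriv m Φ 0‖ ≤ m ! * M / r ^ m := by
    intro r hr0 hr1
    have hsub : closedBall (0 : ℂ) r ⊆ ball 0 1 := closedBall_subset_ball hr1
    have hdc : DiffContOnCl ℂ Φ (ball 0 r) :=
      (hd.mono (closure_ball_subset_closedBall.trans hsub)).diffContOnCl
    exact Complex.norm_iteratedDeriv_le_of_forall_mem_sphere_norm_le m hr0 hdc
      fun z hz ↦ hM z (hsub (sphere_subset_closedBall hz))
  have hpow : Tendsto (fun r : ℝ ↦ r ^ m) (𝓝[<] (1 : ℝ)) (𝓝 1) := by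
    have h := ((continuous_pow m).tendsto (1 : ℝ)).mono_left (nhdsWithin_le_nhds (s := Iio 1))
    simpa using h
  have hlim : Tendsto (fun r : ℝ ↦ (m ! : ℝ) * M / r ^ m) (𝓝[<] (1 : ℝ)) (𝓝 ((m ! : ℝ) * M)) := by
    have h := (tendsto_const_nhds (x := (m ! : ℝ) * M)).div hpow one_ne_zero
    rw [div_one] at h
    exact h
  refine ge_of_tendsto hlim ?_
  filter_upwards [Ioo_mem_nhdsLT one_pos] with r hr
  exact key r hr.1 hr.2

/-- The elementary part `E` is smooth at `0`. [folklore] -/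
private theorem contDiffAt_trendElem (m : ℕ) :
    ContDiffAt ℂ m (fun z ↦ liMap z / 2 - 1 / 6 - (Real.log Real.pi : ℂ) / 2 * liMap z ^ 2 +
        liMap z ^ 2 * Complex.log (liMap z / 2) / 2) 0 := by
  have hA : AnalyticAt ℂ liMap 0 := analyticAt_liMap zero_ne_one
  exact ((((hA.div analyticAt_const two_ne_zero).sub analyticAt_const).sub
    (analyticAt_const.mul (hA.pow 2))).add (((hA.pow 2).mul
      (analyticAt_log_liMap_half (by simp))).div analyticAt_const two_ne_zero)).contDiffAt

/-- The remainder part `Φ` is smooth at `0`. [folklore] -/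
private theorem contDiffAt_trendRem (m : ℕ) :
    ContDiffAt ℂ m (fun z ↦ liMap z ^ 2 / 2 * (Complex.digamma (liMap z / 2) -
      Complex.log (liMap z / 2) + (liMap z)⁻¹ + (3 * liMap z ^ 2)⁻¹)) 0 :=
  (differentiableOn_trendRem.analyticAt (ball_mem_nhds (0 : ℂ) one_pos)).contDiffAt

/-- **Cauchy bound for the remainder coefficients**: `‖Φ⁽ᵐ⁾(0)‖ ≤ m! · 2/π`, and `‖Φ(0)‖ ≤ 1/π`.
[folklore] -/
private theorem norm_iteratedDeriv_trendRem_le (m : ℕ) :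
    ‖iteratedDeriv m (fun z ↦ liMap z ^ 2 / 2 * (Complex.digamma (liMap z / 2) -
      Complex.log (liMap z / 2) + (liMap z)⁻¹ + (3 * liMap z ^ 2)⁻¹)) 0‖ ≤ m ! * (2 / Real.pi) := by
  refine norm_iteratedDeriv_le_of_forall_mem_unitBall differentiableOn_trendRem (fun z hz ↦ ?_) m
  have hz' : ‖z‖ < 1 := by simpa using hz
  have hre := one_half_lt_re_liMap hz'
  refine (norm_trendRem_le hz').trans ?_
  rw [div_le_div_iff₀ (by positivity) Real.pi_pos]
  nlinarith [Real.pi_pos]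

/-- The value at `0`: `‖Φ(0)‖ ≤ 1/π`. [folklore] -/
private theorem norm_trendRem_zero_le :
    ‖iteratedDeriv 0 (fun z ↦ liMap z ^ 2 / 2 * (Complex.digamma (liMap z / 2) -
      Complex.log (liMap z / 2) + (liMap z)⁻¹ + (3 * liMap z ^ 2)⁻¹)) 0‖ ≤ 1 / Real.pi := by
  rw [iteratedDeriv_zero]
  have h := norm_trendRem_le (z := 0) (by simp)
  simpa using h

/-! ### The trend `λ_n − S_n` as a Taylor coefficient -/

/-- The principal `log ζ₁` is analytic at `s = 1` (`ζ₁(1) = 1`). [folklore] -/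
private theorem analyticAt_log_riemannZeta₁_one :
    AnalyticAt ℂ (fun s ↦ Complex.log (riemannZeta₁ s)) 1 :=
  (differentiable_riemannZeta₁.analyticAt 1).clog (by rw [riemannZeta₁_one]; exact one_mem_slitPlane)

/-- `(log ζ₁)^{(j+1)}(1) = (ζ₁'/ζ₁)^{(j)}(1)`. [folklore] -/
private theorem iteratedDeriv_succ_log_riemannZeta₁_one (j : ℕ) :
    iteratedDeriv (j + 1) (fun s ↦ Complex.log (riemannZeta₁ s)) 1 =
      iteratedDeriv j (logDeriv riemannZeta₁) 1 := by
  rw [iteratedDeriv_succ']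
  refine Filter.EventuallyEq.iteratedDeriv_eq j ?_
  have hV : ∀ᶠ s in 𝓝 (1 : ℂ), riemannZeta₁ s ∈ slitPlane :=
    differentiable_riemannZeta₁.continuous.continuousAt.eventually_mem
      (isOpen_slitPlane.mem_nhds (by rw [riemannZeta₁_one]; exact one_mem_slitPlane))
  filter_upwards [hV] with s hs
  rw [((differentiable_riemannZeta₁ s).hasDerivAt.clog hs).deriv, logDeriv_apply]

/-- **The oscillating part as the Li functional of `log ζ₁`**: for `n ≥ 1`,
`S_n := Σ_{j<n} C(n,j+1) Re q_j = Re( dⁿ/dsⁿ[s^{n−1} log ζ₁(s)](1) ) / (n−1)!`, `q_j = (ζ₁'/ζ₁)^{(j)}(1)/j!`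
(so `S_n = −Σ_{j=1}^{n} C(n,j) η_{j−1}` with Bombieri–Lagarias' `η_j = −q_j`). [cite: Voros2006, §4 eq. (4.2)] -/
theorem keiperLiOsc_eq_iteratedDeriv {n : ℕ} (hn : 1 ≤ n) :
    ∑ j ∈ Finset.range n, (n.choose (j + 1) : ℝ) * (Xiao2020.zetaOneLogDerivCoeff j).re =
      (iteratedDeriv n (fun s ↦ s ^ (n - 1) * Complex.log (riemannZeta₁ s)) 1 /
        ((n - 1)! : ℂ)).re := by
  rw [iteratedDeriv_pow_mul_one_eq_sum hn analyticAt_log_riemannZeta₁_one.contDiffAt,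
    Finset.sum_div, Complex.re_sum]
  refine Finset.sum_congr rfl fun j _ ↦ ?_
  rw [iteratedDeriv_succ_log_riemannZeta₁_one]
  have hf : ((n - 1)! : ℂ) ≠ 0 := by exact_mod_cast Nat.factorial_ne_zero _
  have hj : (j ! : ℂ) ≠ 0 := by exact_mod_cast Nat.factorial_ne_zero _
  have hq : iteratedDeriv j (logDeriv riemannZeta₁) 1 = (j ! : ℂ) * Xiao2020.zetaOneLogDerivCoeff j := by
    unfold Xiao2020.zetaOneLogDerivCoeff; field_simp
  rw [hq]
  have : (n.choose (j + 1) : ℂ) * (((n - 1)! : ℂ) / (j ! : ℂ)) *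
      ((j ! : ℂ) * Xiao2020.zetaOneLogDerivCoeff j) / ((n - 1)! : ℂ) =
      ((n.choose (j + 1) : ℝ) : ℂ) * Xiao2020.zetaOneLogDerivCoeff j := by
    push_cast; field_simp
  rw [this, Complex.re_ofReal_mul]

/-- Near `s = 1`, `G = log ξ − log ζ₁` has derivative `1/s + Γℝ'/Γℝ(s)` — the archimedean part of
`ξ'/ξ = 1/s + Γℝ'/Γℝ + ζ₁'/ζ₁` (`logDeriv_riemannXi_eq`). [folklore] -/
private theorem hasDerivAt_logXi_sub_logZetaOne_eventually :
    ∀ᶠ s in 𝓝 (1 : ℂ), HasDerivAt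
      (fun s ↦ Complex.log (riemannXi s) - Complex.log (riemannZeta₁ s)) (s⁻¹ + logDeriv Gammaℝ s) s := by
  have hXi : ∀ᶠ s in 𝓝 (1 : ℂ), riemannXi s ∈ slitPlane :=
    differentiable_riemannXi.continuous.continuousAt.eventually_mem
      (isOpen_slitPlane.mem_nhds (by rw [riemannXi_one, mem_slitPlane_iff]; norm_num))
  have hZ : ∀ᶠ s in 𝓝 (1 : ℂ), riemannZeta₁ s ∈ slitPlane :=
    differentiable_riemannZeta₁.continuous.continuousAt.eventually_mem
      (isOpen_slitPlane.mem_nhds (by rw [riemannZeta₁_one]; exact one_mem_slitPlane))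
  have hre : ∀ᶠ s in 𝓝 (1 : ℂ), 0 < s.re :=
    (isOpen_lt continuous_const Complex.continuous_re).mem_nhds (by simp)
  filter_upwards [hXi, hZ, hre] with s hxi hz hs
  have hζ : riemannZeta₁ s ≠ 0 := slitPlane_ne_zero hz
  have h1 := (differentiable_riemannXi s).hasDerivAt.clog hxi
  have h2 := (differentiable_riemannZeta₁ s).hasDerivAt.clog hz
  refine (h1.sub h2).congr_deriv ?_
  have h3 : deriv riemannXi s / riemannXi s =
      s⁻¹ + logDeriv Gammaℝ s + deriv riemannZeta₁ s / riemannZeta₁ s := by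
    rw [← logDeriv_apply, ← logDeriv_apply, logDeriv_riemannXi_eq hs hζ, one_div]
  rw [h3]; ring

/-- **The generating function of the trend**: near `z = 0`,
`d/dz [G(m(z))] = 𝒜(z) := L + (−Log π/2 + ψ(L/2)/2) L²` with `L = m(z) = 1/(1−z)`
(`Γℝ'/Γℝ(s) = −½ log π + ½ ψ(s/2)`, `m' = m²`). [folklore] -/
private theorem deriv_logXi_sub_logZetaOne_comp_liMap_eventuallyEq :
    deriv ((fun s ↦ Complex.log (riemannXi s) - Complex.log (riemannZeta₁ s)) ∘ liMap) =ᶠ[𝓝 (0 : ℂ)]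
      fun z ↦ liMap z + (-(Complex.log Real.pi) / 2 + Complex.digamma (liMap z / 2) / 2) *
        liMap z ^ 2 := by
  have hc : ContinuousAt liMap 0 := (analyticAt_liMap zero_ne_one).continuousAt
  have hG := hasDerivAt_logXi_sub_logZetaOne_eventually
  rw [← liMap_zero] at hG
  filter_upwards [hc.eventually hG, Metric.ball_mem_nhds (0 : ℂ) one_pos] with z hz hzb
  have hz' : ‖z‖ < 1 := by simpa using hzb
  have hz1 := ne_one_of_norm_lt_one hz'
  rw [(hz.comp z (hasDerivAt_liMap hz1)).deriv]
  have hpos : 0 < (liMap z).re := by linarith [one_half_lt_re_liMap hz']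
  rw [logDeriv_Gammaℝ (half_ne_neg_nat_of_re_pos' hpos)]
  have hL0 := liMap_ne_zero z hz1
  field_simp

/-- **The trend as the Li functional of `G = log ξ − log ζ₁`**: for `n ≥ 1`,
`λ_n − S_n = Re( dⁿ/dsⁿ[s^{n−1} G(s)](1) ) / (n−1)!`. [cite: Li1997, eq. (1.4)] -/
theorem keiperLiCoeff_sub_osc_eq_liFunctional {n : ℕ} (hn : 1 ≤ n) :
    keiperLiCoeff n - ∑ j ∈ Finset.range n, (n.choose (j + 1) : ℝ) *
        (Xiao2020.zetaOneLogDerivCoeff j).re =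
      (iteratedDeriv n (fun s ↦ s ^ (n - 1) *
        (Complex.log (riemannXi s) - Complex.log (riemannZeta₁ s))) 1 / ((n - 1)! : ℂ)).re := by
  have hXi := analyticAt_log_riemannXi_one
  have hZ := analyticAt_log_riemannZeta₁_one
  have hp : ContDiffAt ℂ n (fun s : ℂ ↦ s ^ (n - 1)) 1 := (contDiff_id.pow _).contDiffAt
  have hsplit : iteratedDeriv n (fun s ↦ s ^ (n - 1) *
      (Complex.log (riemannXi s) - Complex.log (riemannZeta₁ s))) 1 =
      iteratedDeriv n (fun s ↦ s ^ (n - 1) * Complex.log (riemannXi s)) 1 -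
        iteratedDeriv n (fun s ↦ s ^ (n - 1) * Complex.log (riemannZeta₁ s)) 1 := by
    rw [← iteratedDeriv_fun_sub (hp.mul hXi.contDiffAt) (hp.mul hZ.contDiffAt)]
    congr 1; funext s; ring
  rw [keiperLiOsc_eq_iteratedDeriv hn, keiperLiCoeff, hsplit, sub_div, Complex.sub_re]

/-- **The trend as a Taylor coefficient** (Li's change of variables `s = 1/(1−z)`): for `n ≥ 1`,
`λ_n − S_n = Re 𝒜^{(n−1)}(0) / (n−1)!`. [cite: Li1997, eqs. (1.1), (1.4)–(1.5)] -/
theorem keiperLiCoeff_sub_osc_eq_iteratedDeriv {n : ℕ} (hn : 1 ≤ n) :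
    keiperLiCoeff n - ∑ j ∈ Finset.range n, (n.choose (j + 1) : ℝ) *
        (Xiao2020.zetaOneLogDerivCoeff j).re =
      (iteratedDeriv (n - 1) (fun z ↦ liMap z + (-(Complex.log Real.pi) / 2 +
        Complex.digamma (liMap z / 2) / 2) * liMap z ^ 2) 0 / ((n - 1)! : ℂ)).re := by
  have hG : AnalyticAt ℂ (fun s ↦ Complex.log (riemannXi s) - Complex.log (riemannZeta₁ s)) 1 :=
    analyticAt_log_riemannXi_one.sub analyticAt_log_riemannZeta₁_one
  have hli := iteratedDeriv_pow_mul_eq_iteratedDeriv_comp_liMap n hG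
  rw [keiperLiCoeff_sub_osc_eq_liFunctional hn]
  obtain ⟨m, rfl⟩ : ∃ m, n = m + 1 := ⟨n - 1, by omega⟩
  simp only [Nat.add_sub_cancel] at hli ⊢
  rw [hli, iteratedDeriv_succ', deriv_logXi_sub_logZetaOne_comp_liMap_eventuallyEq.iteratedDeriv_eq]

/-- Pointwise splitting `𝒜 = E + Φ` of the generating function (`z ≠ 1`). [folklore] -/
private theorem trendGen_eq_trendElem_add_trendRem {z : ℂ} (hz : z ≠ 1) :
    liMap z + (-(Complex.log Real.pi) / 2 + Complex.digamma (liMap z / 2) / 2) * liMap z ^ 2 =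
      (liMap z / 2 - 1 / 6 - (Real.log Real.pi : ℂ) / 2 * liMap z ^ 2 +
        liMap z ^ 2 * Complex.log (liMap z / 2) / 2) +
      liMap z ^ 2 / 2 * (Complex.digamma (liMap z / 2) - Complex.log (liMap z / 2) + (liMap z)⁻¹ +
        (3 * liMap z ^ 2)⁻¹) := by
  have hL0 := liMap_ne_zero z hz
  rw [Complex.ofReal_log Real.pi_pos.le]
  field_simp
  ring

/-- The harmonic number as a complex sum: `H_n = Σ_{i<n} 1/(i+1)`. [folklore] -/
private theorem harmonic_cast_eq_sum (n : ℕ) :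
    (((harmonic n : ℚ) : ℝ) : ℂ) = ∑ i ∈ Finset.range n, ((i : ℂ) + 1)⁻¹ := by
  simp [harmonic]

/-! ### The RH-free trend law -/

/-- **RH-FREE. The trend law of the Keiper–Li coefficients** (Voros 2006, §4, (4.6): the
"archimedean" part `S̄_n = λ_n − S_n` of `λ_n`, `S_n = −Σ_{j=1}^n C(n,j) η_{j−1}` the contribution
of `(s−1)ζ(s)`, satisfies `S̄_n ∼ ½n(log n − 1 + γ − log 2π) + 3/4 − …` unconditionally).
Here in the closed and uniform form: for every `n ≥ 1`,

  `| (λ_n − S_n) − ( (n/2)(H_n − 1 − log 2π) + 1/2 ) | ≤ 2/π`,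

`H_n` the harmonic number, `S_n = Σ_{j<n} C(n,j+1) Re q_j` (`q_j = (ζ₁'/ζ₁)^{(j)}(1)/j! = −η_j`).
No hypothesis on the zeros of `ζ` enters: the trend is the Li functional of the Gamma factor
`log Γ(1+s/2) − (s/2) log π`, computed through the generating function
`𝒜(z) = L + (−log π/2 + ψ(L/2)/2)L²`, `L = 1/(1−z)`, split as an elementary part with Taylor
coefficients `(n/2)(H_n − 1 − log 2π) + 1/2 − [n=1]/6` plus `(L²/2)·(Stirling remainder of ψ at L/2)`,
which is bounded by `2/π` on the unit disc (Cauchy's estimate).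
-- TODO(general form): Voros proves the full asymptotic expansion `S̄_n = ½n[ψ(n) + log 2 − 1 + 2γ]
-- + 1 − (log 4π + γ)n/2 (mod o(n^{−N}) ∀N)`, i.e. the error here is `o(n^{−N})`, not just `O(1)`.
[cite: Voros2006, §4 eq. (4.6)] -/
theorem abs_keiperLiCoeff_sub_osc_sub_trend_le {n : ℕ} (hn : 1 ≤ n) :
    |keiperLiCoeff n - ∑ j ∈ Finset.range n, (n.choose (j + 1) : ℝ) *
        (Xiao2020.zetaOneLogDerivCoeff j).re -
      (n / 2 * ((harmonic n : ℝ) - 1 - Real.log (2 * Real.pi)) + 1 / 2)| ≤ 2 / Real.pi := by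
  rw [keiperLiCoeff_sub_osc_eq_iteratedDeriv hn]
  obtain ⟨m, rfl⟩ : ∃ m, n = m + 1 := ⟨n - 1, by omega⟩
  simp only [Nat.add_sub_cancel]
  have hev : (fun z ↦ liMap z + (-(Complex.log Real.pi) / 2 + Complex.digamma (liMap z / 2) / 2) *
      liMap z ^ 2) =ᶠ[𝓝 (0 : ℂ)] fun z ↦ (liMap z / 2 - 1 / 6 - (Real.log Real.pi : ℂ) / 2 *
        liMap z ^ 2 + liMap z ^ 2 * Complex.log (liMap z / 2) / 2) +
      liMap z ^ 2 / 2 * (Complex.digamma (liMap z / 2) - Complex.log (liMap z / 2) + (liMap z)⁻¹ +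
        (3 * liMap z ^ 2)⁻¹) := by
    filter_upwards [eventually_ne_nhds (zero_ne_one : (0 : ℂ) ≠ 1)] with z hz
    exact trendGen_eq_trendElem_add_trendRem hz
  rw [hev.iteratedDeriv_eq, iteratedDeriv_fun_add (contDiffAt_trendElem m) (contDiffAt_trendRem m),
    iteratedDeriv_trendElem_zero, ← harmonic_cast_eq_sum]
  set Φm := iteratedDeriv m (fun z ↦ liMap z ^ 2 / 2 * (Complex.digamma (liMap z / 2) -
    Complex.log (liMap z / 2) + (liMap z)⁻¹ + (3 * liMap z ^ 2)⁻¹)) 0 with hΦm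
  have hfact : (m ! : ℂ) ≠ 0 := by exact_mod_cast Nat.factorial_ne_zero m
  have hfpos : (0 : ℝ) < m ! := by exact_mod_cast Nat.factorial_pos m
  -- the elementary part is real
  set c : ℝ := if m = 0 then 1 / 6 else 0 with hc
  have hX : (m ! : ℂ) * (((m : ℂ) + 1) / 2 * ((((harmonic (m + 1) : ℚ) : ℝ) : ℂ) - 1 - Real.log 2 -
      Real.log Real.pi) + 1 / 2 - if m = 0 then 1 / 6 else 0) =
      (((m ! : ℝ) * (((m : ℝ) + 1) / 2 * (((harmonic (m + 1) : ℚ) : ℝ) - 1 - Real.log 2 -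
        Real.log Real.pi) + 1 / 2 - c) : ℝ) : ℂ) := by
    rw [hc]; split_ifs <;> push_cast <;> ring
  rw [hX, add_div, Complex.add_re, ← Complex.ofReal_natCast, ← Complex.ofReal_div, Complex.ofReal_re,
    mul_div_cancel_left₀ _ hfpos.ne', Real.log_mul two_ne_zero Real.pi_ne_zero]
  have hsimp : ((m : ℝ) + 1) / 2 * (((harmonic (m + 1) : ℚ) : ℝ) - 1 - Real.log 2 - Real.log Real.pi) +
      1 / 2 - c + (Φm / ((m ! : ℝ) : ℂ)).re - (((m + 1 : ℕ) : ℝ) / 2 *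
        (((harmonic (m + 1) : ℚ) : ℝ) - 1 - (Real.log 2 + Real.log Real.pi)) + 1 / 2) =
      (Φm / ((m ! : ℝ) : ℂ)).re - c := by
    push_cast; ring
  rw [hsimp]
  have hΦre : |(Φm / ((m ! : ℝ) : ℂ)).re| ≤ ‖Φm‖ / m ! := by
    refine (Complex.abs_re_le_norm _).trans (le_of_eq ?_)
    rw [norm_div, Complex.norm_of_nonneg hfpos.le]
  have hc0 : 0 ≤ c := by rw [hc]; split_ifs <;> norm_num
  have htri : |(Φm / ((m ! : ℝ) : ℂ)).re - c| ≤ ‖Φm‖ / m ! + c := by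
    have := abs_sub _ _ |>.trans (add_le_add hΦre (le_of_eq (abs_of_nonneg hc0)))
    exact this
  refine htri.trans ?_
  rcases Nat.eq_zero_or_pos m with rfl | hm
  · -- `n = 1`: `‖Φ(0)‖ ≤ 1/π` and `1/6 + 1/π ≤ 2/π` as `π ≤ 4 ≤ 6`
    have h0 : ‖Φm‖ ≤ 1 / Real.pi := by rw [hΦm]; exact norm_trendRem_zero_le
    simp only [hc, if_true, Nat.factorial_zero, Nat.cast_one, div_one]
    have hπ := Real.pi_le_four
    have hπ0 := Real.pi_pos
    have : 1 / 6 ≤ 1 / Real.pi := by rw [div_le_div_iff₀ (by norm_num) hπ0]; linarith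
    have h2 : 2 / Real.pi = 1 / Real.pi + 1 / Real.pi := by ring
    linarith
  · have h1 : ‖Φm‖ ≤ m ! * (2 / Real.pi) := by rw [hΦm]; exact norm_iteratedDeriv_trendRem_le m
    simp only [hc, if_neg hm.ne', add_zero]
    rw [div_le_iff₀ hfpos]
    linarith

/-! ### Bombieri–Lagarias' finite form of the trend -/

/-- `G^{(j+1)}(1) = (d/ds)^j [1/s + Γℝ'/Γℝ](1)` for `G = log ξ − log ζ₁`. [folklore] -/
private theorem iteratedDeriv_succ_logXi_sub_logZetaOne_one (j : ℕ) :
    iteratedDeriv (j + 1) (fun s ↦ Complex.log (riemannXi s) - Complex.log (riemannZeta₁ s)) 1 =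
      iteratedDeriv j (fun s : ℂ ↦ s⁻¹) 1 + iteratedDeriv j (logDeriv Gammaℝ) 1 := by
  rw [iteratedDeriv_succ']
  have hev : deriv (fun s ↦ Complex.log (riemannXi s) - Complex.log (riemannZeta₁ s)) =ᶠ[𝓝 (1 : ℂ)]
      fun s ↦ s⁻¹ + logDeriv Gammaℝ s :=
    hasDerivAt_logXi_sub_logZetaOne_eventually.mono fun s hs ↦ hs.deriv
  rw [hev.iteratedDeriv_eq, iteratedDeriv_fun_add (contDiffAt_inv ℂ one_ne_zero)
    (analyticAt_logDeriv_Gammaℝ (by simp)).contDiffAt]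

/-- `Γℝ'/Γℝ(1) = −½ log π − log 2 − γ/2` (`ψ(½) = −γ − 2 log 2`). [folklore] -/
private theorem logDeriv_Gammaℝ_one_eq :
    logDeriv Gammaℝ 1 =
      ((-Real.log Real.pi / 2 - Real.log 2 - Real.eulerMascheroniConstant / 2 : ℝ) : ℂ) := by
  have hhalf : ∀ m : ℕ, (1 : ℂ) / 2 ≠ -m := fun m h ↦ by
    have := congrArg Complex.re h
    simp at this
    linarith [(m.cast_nonneg : (0 : ℝ) ≤ m)]
  rw [logDeriv_Gammaℝ hhalf, Complex.digamma_one_half, ← Complex.ofReal_log Real.pi_pos.le,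
    show Complex.log 2 = ((Real.log 2 : ℝ) : ℂ) by
      rw [show (2 : ℂ) = ((2 : ℝ) : ℂ) by norm_num, Complex.ofReal_log (by norm_num)]]
  push_cast
  ring

/-- `Σ_{j<n} (−1)ʲ C(n,j+1) = 1` for `n ≥ 1`. [folklore] -/
private theorem sum_range_neg_one_pow_mul_choose_succ {n : ℕ} (hn : 1 ≤ n) :
    ∑ j ∈ Finset.range n, (-1 : ℂ) ^ j * (n.choose (j + 1) : ℂ) = 1 := by
  have h := Int.alternating_sum_range_choose_of_ne (n := n) (by omega)
  rw [Finset.sum_range_succ'] at h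
  have h' := congrArg (Int.cast : ℤ → ℂ) h
  push_cast at h'
  simp only [pow_succ, mul_neg, mul_one, neg_mul, Finset.sum_neg_distrib, Nat.choose_zero_right,
    Nat.cast_one] at h'
  linear_combination -h'

/-- **RH-FREE. Bombieri–Lagarias' arithmetic formula, archimedean part** (Bombieri–Lagarias 1999,
Thm. 2; Voros 2006, (4.2)–(4.3)): for `n ≥ 1` the trend `S̄_n = λ_n − S_n` is the finite expression

  `S̄_n = 1 − (n/2)(γ + log π + 2 log 2) + Σ_{j=2}^{n} (−1)ʲ C(n,j) (1 − 2^{−j}) ζ(j)`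

(`ζ(j)` real for `j ≥ 2`; we print `Re ζ(j)`). Proof: Leibniz for `s^{n−1} G(s)` at `1`,
`G' = 1/s + Γℝ'/Γℝ`, `(1/s)^{(j)}(1) = (−1)ʲ j!`, `(Γℝ'/Γℝ)^{(j)}(1) = (−1)^{j+1} j! (1−2^{−j−1})ζ(j+1)`
(`j ≥ 1`, polygamma series) and `Γℝ'/Γℝ(1) = −½log π − log 2 − γ/2`.
[cite: Voros2006, §4 eqs. (4.2)–(4.3)] -/
theorem keiperLiCoeff_sub_osc_eq_finite_sum {n : ℕ} (hn : 1 ≤ n) :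
    keiperLiCoeff n - ∑ j ∈ Finset.range n, (n.choose (j + 1) : ℝ) *
        (Xiao2020.zetaOneLogDerivCoeff j).re =
      1 - n / 2 * (Real.eulerMascheroniConstant + Real.log Real.pi + 2 * Real.log 2) +
        ∑ j ∈ Finset.Icc 2 n, (-1) ^ j * (n.choose j : ℝ) * (1 - 1 / 2 ^ j) *
          (riemannZeta j).re := by
  have hG : AnalyticAt ℂ (fun s ↦ Complex.log (riemannXi s) - Complex.log (riemannZeta₁ s)) 1 :=
    analyticAt_log_riemannXi_one.sub analyticAt_log_riemannZeta₁_one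
  rw [keiperLiCoeff_sub_osc_eq_liFunctional hn, iteratedDeriv_pow_mul_one_eq_sum hn hG.contDiffAt,
    Finset.sum_div]
  have hf : ((n - 1)! : ℂ) ≠ 0 := by exact_mod_cast Nat.factorial_ne_zero _
  -- the terms
  have hterm : ∀ j ∈ Finset.range n, (n.choose (j + 1) : ℂ) * (((n - 1)! : ℂ) / (j ! : ℂ)) *
      iteratedDeriv (j + 1) (fun s ↦ Complex.log (riemannXi s) - Complex.log (riemannZeta₁ s)) 1 /
        ((n - 1)! : ℂ) =
      (-1) ^ j * (n.choose (j + 1) : ℂ) + (n.choose (j + 1) : ℂ) *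
        (if j = 0 then logDeriv Gammaℝ 1 else
          (-1) ^ (j + 1) * ((1 - 1 / 2 ^ (j + 1)) * riemannZeta ((j + 1 : ℕ) : ℂ))) := by
    intro j _
    have hj : (j ! : ℂ) ≠ 0 := by exact_mod_cast Nat.factorial_ne_zero _
    rw [iteratedDeriv_succ_logXi_sub_logZetaOne_one, Xiao2020.iteratedDeriv_inv_one]
    split_ifs with hj0
    · subst hj0; simp; field_simp
    · have hG' := (Xiao2020.hasSum_iteratedDeriv_logDeriv_Gammaℝ_one (k := j) (by omega)).tsum_eq
      have hO := (Xiao2020.hasSum_inv_odd_pow (k := j + 1) (by omega)).tsum_eq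
      rw [← hG', tsum_mul_left, hO]
      field_simp
  rw [Finset.sum_congr rfl hterm, Finset.sum_add_distrib, sum_range_neg_one_pow_mul_choose_succ hn]
  obtain ⟨m, rfl⟩ : ∃ m, n = m + 1 := ⟨n - 1, by omega⟩
  rw [Finset.sum_range_succ']
  simp only [zero_add, Nat.choose_one_right, if_true, Nat.add_one_ne_zero, if_false]
  -- reindex the zeta sum to `Icc 2 (m+1)`
  have hre : ∑ j ∈ Finset.Icc 2 (m + 1), (-1 : ℝ) ^ j * ((m + 1).choose j : ℝ) * (1 - 1 / 2 ^ j) *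
      (riemannZeta j).re = (∑ k ∈ Finset.range m, ((m + 1).choose (k + 1 + 1) : ℂ) *
        ((-1) ^ (k + 1 + 1) * ((1 - 1 / 2 ^ (k + 1 + 1)) * riemannZeta ((k + 1 + 1 : ℕ) : ℂ)))).re := by
    rw [← Finset.Ico_add_one_right_eq_Icc, Finset.sum_Ico_eq_sum_range,
      show m + 1 + 1 - 2 = m by omega, Complex.re_sum]
    refine Finset.sum_congr rfl fun k _ ↦ ?_
    rw [show 2 + k = k + 1 + 1 by omega]
    have : ((m + 1).choose (k + 1 + 1) : ℂ) * ((-1) ^ (k + 1 + 1) * ((1 - 1 / 2 ^ (k + 1 + 1)) *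
        riemannZeta ((k + 1 + 1 : ℕ) : ℂ))) = (((-1 : ℝ) ^ (k + 1 + 1) * ((m + 1).choose (k + 1 + 1) : ℝ) *
          (1 - 1 / 2 ^ (k + 1 + 1)) : ℝ) : ℂ) * riemannZeta ((k + 1 + 1 : ℕ) : ℂ) := by
      push_cast; ring
    rw [this, Complex.re_ofReal_mul]
  rw [hre, logDeriv_Gammaℝ_one_eq]
  simp only [Complex.add_re, Complex.one_re, Complex.mul_re, Complex.natCast_re, Complex.natCast_im,
    Complex.ofReal_re, Complex.ofReal_im, mul_zero, sub_zero]
  push_cast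
  ring

/-- Bounds for the harmonic numbers from Mathlib's Euler–Mascheroni sequences:
`log n + γ ≤ H_n ≤ log n + γ + 1/n` for `n ≥ 1`. [folklore] -/
private theorem log_add_eulerMascheroni_le_harmonic {n : ℕ} (hn : 1 ≤ n) :
    Real.log n + Real.eulerMascheroniConstant ≤ (harmonic n : ℝ) ∧
      (harmonic n : ℝ) ≤ Real.log n + Real.eulerMascheroniConstant + 1 / n := by
  have hn0 : (0 : ℝ) < n := by exact_mod_cast hn
  constructor
  · have h := Real.eulerMascheroniConstant_lt_eulerMascheroniSeq' n
    rw [Real.eulerMascheroniSeq', if_neg (by omega)] at h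
    linarith
  · have h1 := Real.eulerMascheroniSeq_lt_eulerMascheroniConstant n
    rw [Real.eulerMascheroniSeq] at h1
    have h2 : Real.log (n + 1) ≤ Real.log n + 1 / n := by
      have h3 := Real.log_le_sub_one_of_pos (x := ((n : ℝ) + 1) / n) (by positivity)
      rw [Real.log_div (by positivity) hn0.ne'] at h3
      have h4 : ((n : ℝ) + 1) / n - 1 = 1 / n := by field_simp; ring
      linarith
    linarith

/-- **RH-FREE. The trend law in logarithmic form** (Maślanka's empirical trend
`λ̄_n ≈ ½ n log n + c n`, `c = ½(γ − 1 − log 2π)`, proved unconditionally by Voros): for `n ≥ 1`,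

  `(n/2)(log n + γ − 1 − log 2π) + 1/2 − 2/π ≤ λ_n − S_n ≤ (n/2)(log n + γ − 1 − log 2π) + 1 + 2/π`.

[cite: Voros2006, §4 eq. (4.6)] -/
theorem keiperLiTrend_log_bounds {n : ℕ} (hn : 1 ≤ n) :
    n / 2 * (Real.log n + Real.eulerMascheroniConstant - 1 - Real.log (2 * Real.pi)) + 1 / 2 -
          2 / Real.pi ≤
        keiperLiCoeff n - ∑ j ∈ Finset.range n, (n.choose (j + 1) : ℝ) *
          (Xiao2020.zetaOneLogDerivCoeff j).re ∧
      keiperLiCoeff n - ∑ j ∈ Finset.range n, (n.choose (j + 1) : ℝ) *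
          (Xiao2020.zetaOneLogDerivCoeff j).re ≤
        n / 2 * (Real.log n + Real.eulerMascheroniConstant - 1 - Real.log (2 * Real.pi)) + 1 +
          2 / Real.pi := by
  have h := abs_le.1 (abs_keiperLiCoeff_sub_osc_sub_trend_le hn)
  have hn0 : (0 : ℝ) < n := by exact_mod_cast hn
  obtain ⟨hlow, hup⟩ := log_add_eulerMascheroni_le_harmonic hn
  have e1 : (n : ℝ) / 2 * (Real.log n + Real.eulerMascheroniConstant) ≤ n / 2 * (harmonic n : ℝ) :=
    mul_le_mul_of_nonneg_left hlow (by positivity)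
  have e2 : (n : ℝ) / 2 * (harmonic n : ℝ) ≤
      n / 2 * (Real.log n + Real.eulerMascheroniConstant) + 1 / 2 := by
    have := mul_le_mul_of_nonneg_left hup (show (0 : ℝ) ≤ n / 2 by positivity)
    have e3 : (n : ℝ) / 2 * (Real.log n + Real.eulerMascheroniConstant + 1 / n) =
        n / 2 * (Real.log n + Real.eulerMascheroniConstant) + 1 / 2 := by field_simp
    linarith
  constructor
  · linarith [h.1]
  · linarith [h.2]

/-! ### Decay of the error: `ε_n = O(1/n)` (one more Stirling term and one derivative)

With the fourth-order Stirling remainder `R₂(w) = ψ(w) − Log w + 1/(2w) + 1/(12w²) − 1/(120w⁴)`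
(`‖R₂(w)‖ ≤ 5/(4π³‖w‖⁴ Re w)`, `‖R₂′(w)‖ ≤ 15/(2π³‖w‖⁵ Re w)`) the remainder part splits as
`Φ = (1−z)²/15 + Φ₂`, `Φ₂ = (L²/2)R₂(L/2)`, and `Φ₂′ = L³R₂(L/2) + (L⁴/4)R₂′(L/2)` is BOUNDED by `640/π³`
on the unit disc; Cauchy's estimate for `Φ₂′` gives `|[zᵐ]Φ₂| = |[z^{m−1}]Φ₂′|/m ≤ (640/π³)/m`. -/

/-- Fourth-order Stirling for `ψ` on the right half-plane (`ν = 2` of `norm_digamma_sub_stirlingSeries_le`):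
`‖ψ(w) − Log w + 1/(2w) + 1/(12w²) − 1/(120w⁴)‖ ≤ 5/(4π³ ‖w‖⁴ Re w)`. [cite: AndrewsAskeyRoy1999, Cor 1.4.5] -/
theorem norm_digamma_sub_stirling_four_le {w : ℂ} (hw : 0 < w.re) :
    ‖Complex.digamma w - Complex.log w + 1 / (2 * w) + 1 / (12 * w ^ 2) - 1 / (120 * w ^ 4)‖ ≤
      5 / (4 * Real.pi ^ 3) / (‖w‖ ^ 4 * w.re) := by
  have h := Literature.Analysis.SpecialFunctions.Complex.norm_digamma_sub_stirlingSeries_le hw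
    (two_ne_zero (α := ℕ))
  have hw0 : w ≠ 0 := fun h0 ↦ by rw [h0] at hw; simp at hw
  have hb2 : (bernoulli 2 : ℂ) = 1 / 6 := by
    rw [bernoulli_eq_bernoulli'_of_ne_one (by norm_num), bernoulli'_two]; push_cast; ring
  have hb4 : (bernoulli 4 : ℂ) = -1 / 30 := by
    rw [bernoulli_eq_bernoulli'_of_ne_one (by norm_num), bernoulli'_four]; push_cast; ring
  rw [show Finset.Icc 1 2 = {1, 2} by rfl, Finset.sum_pair (by norm_num)] at h
  simp only [Nat.mul_one, hb2, Nat.cast_one, show 2 * 2 = 4 by rfl, hb4, Nat.cast_ofNat] at h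
  have heq : Complex.digamma w - (Complex.log w - 1 / (2 * w) -
      (1 / 6 / (2 * 1) / w ^ 2 + -1 / 30 / (2 * 2) / w ^ 4)) =
      Complex.digamma w - Complex.log w + 1 / (2 * w) + 1 / (12 * w ^ 2) - 1 / (120 * w ^ 4) := by
    field_simp; ring
  rw [heq] at h
  refine h.trans (le_of_eq ?_)
  simp only [Nat.factorial, Nat.succ_eq_add_one]
  push_cast
  have hπ : Real.pi ≠ 0 := Real.pi_ne_zero
  field_simp
  ring

/-- Stirling for the trigamma function (`ν = 2` of `norm_deriv_digamma_sub_stirlingSeries_le`):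
`‖ψ′(w) − 1/w − 1/(2w²) − 1/(6w³) + 1/(30w⁵)‖ ≤ 15/(2π³ ‖w‖⁵ Re w)`. [cite: AndrewsAskeyRoy1999, Cor 1.4.5] -/
theorem norm_deriv_digamma_sub_stirling_four_le {w : ℂ} (hw : 0 < w.re) :
    ‖deriv Complex.digamma w - 1 / w - 1 / (2 * w ^ 2) - 1 / (6 * w ^ 3) + 1 / (30 * w ^ 5)‖ ≤
      15 / (2 * Real.pi ^ 3) / (‖w‖ ^ 5 * w.re) := by
  have h := Literature.Analysis.SpecialFunctions.Complex.norm_deriv_digamma_sub_stirlingSeries_le hw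
    (two_ne_zero (α := ℕ))
  have hw0 : w ≠ 0 := fun h0 ↦ by rw [h0] at hw; simp at hw
  have hb2 : (bernoulli 2 : ℂ) = 1 / 6 := by
    rw [bernoulli_eq_bernoulli'_of_ne_one (by norm_num), bernoulli'_two]; push_cast; ring
  have hb4 : (bernoulli 4 : ℂ) = -1 / 30 := by
    rw [bernoulli_eq_bernoulli'_of_ne_one (by norm_num), bernoulli'_four]; push_cast; ring
  rw [show Finset.Icc 1 2 = {1, 2} by rfl, Finset.sum_pair (by norm_num)] at h
  simp only [Nat.mul_one, hb2, show 2 * 2 = 4 by rfl, hb4] at h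
  have heq : deriv Complex.digamma w - (1 / w + 1 / (2 * w ^ 2) +
      (1 / 6 / w ^ (2 + 1) + -1 / 30 / w ^ (4 + 1))) =
      deriv Complex.digamma w - 1 / w - 1 / (2 * w ^ 2) - 1 / (6 * w ^ 3) + 1 / (30 * w ^ 5) := by
    field_simp; ring
  rw [heq] at h
  refine h.trans (le_of_eq ?_)
  simp only [Nat.factorial, Nat.succ_eq_add_one]
  push_cast
  have hπ : Real.pi ≠ 0 := Real.pi_ne_zero
  field_simp
  ring

/-- The exact error: for `m = n − 1`,
`λ_n − S_n − ((n/2)(H_n − 1 − log 2π) + 1/2) = Re Φ⁽ᵐ⁾(0)/m! − [m = 0]/6`. [folklore] -/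
private theorem keiperLiCoeff_sub_osc_sub_trend_eq (m : ℕ) :
    keiperLiCoeff (m + 1) - ∑ j ∈ Finset.range (m + 1), ((m + 1).choose (j + 1) : ℝ) *
        (Xiao2020.zetaOneLogDerivCoeff j).re -
      ((m + 1 : ℕ) / 2 * ((harmonic (m + 1) : ℝ) - 1 - Real.log (2 * Real.pi)) + 1 / 2) =
    (iteratedDeriv m (fun z ↦ liMap z ^ 2 / 2 * (Complex.digamma (liMap z / 2) -
      Complex.log (liMap z / 2) + (liMap z)⁻¹ + (3 * liMap z ^ 2)⁻¹)) 0 / (m ! : ℂ)).re -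
      if m = 0 then 1 / 6 else 0 := by
  rw [keiperLiCoeff_sub_osc_eq_iteratedDeriv (by omega : 1 ≤ m + 1), Nat.add_sub_cancel]
  have hev : (fun z ↦ liMap z + (-(Complex.log Real.pi) / 2 + Complex.digamma (liMap z / 2) / 2) *
      liMap z ^ 2) =ᶠ[𝓝 (0 : ℂ)] fun z ↦ (liMap z / 2 - 1 / 6 - (Real.log Real.pi : ℂ) / 2 *
        liMap z ^ 2 + liMap z ^ 2 * Complex.log (liMap z / 2) / 2) +
      liMap z ^ 2 / 2 * (Complex.digamma (liMap z / 2) - Complex.log (liMap z / 2) + (liMap z)⁻¹ +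
        (3 * liMap z ^ 2)⁻¹) := by
    filter_upwards [eventually_ne_nhds (zero_ne_one : (0 : ℂ) ≠ 1)] with z hz
    exact trendGen_eq_trendElem_add_trendRem hz
  rw [hev.iteratedDeriv_eq, iteratedDeriv_fun_add (contDiffAt_trendElem m) (contDiffAt_trendRem m),
    iteratedDeriv_trendElem_zero, ← harmonic_cast_eq_sum]
  have hfact : (m ! : ℂ) ≠ 0 := by exact_mod_cast Nat.factorial_ne_zero m
  have hfpos : (0 : ℝ) < m ! := by exact_mod_cast Nat.factorial_pos m
  set c : ℝ := if m = 0 then 1 / 6 else 0 with hc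
  have hX : (m ! : ℂ) * (((m : ℂ) + 1) / 2 * ((((harmonic (m + 1) : ℚ) : ℝ) : ℂ) - 1 - Real.log 2 -
      Real.log Real.pi) + 1 / 2 - if m = 0 then 1 / 6 else 0) =
      (((m ! : ℝ) * (((m : ℝ) + 1) / 2 * (((harmonic (m + 1) : ℚ) : ℝ) - 1 - Real.log 2 -
        Real.log Real.pi) + 1 / 2 - c) : ℝ) : ℂ) := by
    rw [hc]; split_ifs <;> push_cast <;> ring
  rw [hX, add_div, Complex.add_re, ← Complex.ofReal_natCast, ← Complex.ofReal_div, Complex.ofReal_re,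
    mul_div_cancel_left₀ _ hfpos.ne', Real.log_mul two_ne_zero Real.pi_ne_zero]
  push_cast
  ring

/-- `dᵏ/dzᵏ [(1−z)²/15] (0) = 0` for `k ≥ 3`. [folklore] -/
private theorem iteratedDeriv_poly_eq_zero (k : ℕ) :
    iteratedDeriv (k + 3) (fun z : ℂ ↦ (1 - z) ^ 2 / 15) 0 = 0 := by
  have h1 : deriv (fun z : ℂ ↦ (1 - z) ^ 2 / 15) = fun z ↦ -(2 * (1 - z)) / 15 := by
    funext z
    have : HasDerivAt (fun z : ℂ ↦ (1 - z) ^ 2 / 15) ((2 : ℕ) * (1 - z) ^ 1 * (-1) / 15) z :=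
      (((hasDerivAt_id z).const_sub 1).pow 2).div_const 15
    rw [this.deriv]; push_cast; ring
  have h2 : deriv (fun z : ℂ ↦ -(2 * (1 - z)) / 15) = fun _ ↦ 2 / 15 := by
    funext z
    have : HasDerivAt (fun z : ℂ ↦ -(2 * (1 - z)) / 15) (-(2 * (-1)) / 15) z :=
      (((hasDerivAt_id z).const_sub 1).const_mul 2).neg.div_const 15
    rw [this.deriv]; ring
  rw [show k + 3 = ((k + 1) + 1) + 1 by ring, iteratedDeriv_succ', h1, iteratedDeriv_succ', h2,
    iteratedDeriv_succ', deriv_const']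
  simp

/-- On the unit disc, `Φ₂ = Φ − (1−z)²/15 = (L²/2)(ψ(L/2) − Log(L/2)) + L/2 + 1/6 − (1−z)²/15` has
derivative `D = L³(ψ(L/2) − Log(L/2)) + (L⁴/4)ψ′(L/2) − L³/2 + L²/2 + (2/15)(1−z)`. [folklore] -/
private theorem hasDerivAt_trendRem₂ {z : ℂ} (hz : ‖z‖ < 1) :
    HasDerivAt (fun z ↦ liMap z ^ 2 / 2 * (Complex.digamma (liMap z / 2) - Complex.log (liMap z / 2)) +
        liMap z / 2 + 1 / 6 - (1 - z) ^ 2 / 15)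
      (liMap z ^ 3 * (Complex.digamma (liMap z / 2) - Complex.log (liMap z / 2)) +
        liMap z ^ 4 / 4 * deriv Complex.digamma (liMap z / 2) - liMap z ^ 3 / 2 + liMap z ^ 2 / 2 +
        2 / 15 * (1 - z)) z := by
  have hz1 := ne_one_of_norm_lt_one hz
  have hL := hasDerivAt_liMap hz1
  have hw : 0 < (liMap z / 2).re := re_liMap_half_pos hz
  have hψ : HasDerivAt Complex.digamma (deriv Complex.digamma (liMap z / 2)) (liMap z / 2) :=
    ((Literature.Analysis.SpecialFunctions.Complex.differentiableOn_digamma _ hw).differentiableAt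
      ((isOpen_lt continuous_const Complex.continuous_re).mem_nhds hw)).hasDerivAt
  have hψ' : HasDerivAt (fun z ↦ Complex.digamma (liMap z / 2))
      (deriv Complex.digamma (liMap z / 2) * (liMap z ^ 2 / 2)) z := hψ.comp z (hL.div_const 2)
  have hlog := hasDerivAt_log_liMap_half hz
  have hsq : HasDerivAt (fun z ↦ liMap z ^ 2 / 2) ((2 : ℕ) * liMap z ^ 1 * liMap z ^ 2 / 2) z :=
    (hL.pow 2).div_const 2
  have hP : HasDerivAt (fun z : ℂ ↦ (1 - z) ^ 2 / 15) ((2 : ℕ) * (1 - z) ^ 1 * (-1) / 15) z :=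
    (((hasDerivAt_id z).const_sub 1).pow 2).div_const 15
  have h := (((hsq.mul (hψ'.sub hlog)).add (hL.div_const 2)).add_const (1 / 6)).sub hP
  refine h.congr_deriv ?_
  simp only [Pi.sub_apply]
  push_cast
  ring

/-- `Φ₂′` is bounded by `640/π³` on the unit disc: `Φ₂′ = L³R₂(L/2) + (L⁴/4)R₂′(L/2)` with the
fourth-order Stirling remainders, and `‖L‖ ≥ Re L > 1/2`. [folklore] -/
private theorem norm_deriv_trendRem₂_le {z : ℂ} (hz : ‖z‖ < 1) :
    ‖liMap z ^ 3 * (Complex.digamma (liMap z / 2) - Complex.log (liMap z / 2)) +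
        liMap z ^ 4 / 4 * deriv Complex.digamma (liMap z / 2) - liMap z ^ 3 / 2 + liMap z ^ 2 / 2 +
        2 / 15 * (1 - z)‖ ≤ 640 / Real.pi ^ 3 := by
  have hz1 := ne_one_of_norm_lt_one hz
  have hw : 0 < (liMap z / 2).re := re_liMap_half_pos hz
  have hre : 1 / 2 < (liMap z).re := one_half_lt_re_liMap hz
  have hL0 : liMap z ≠ 0 := liMap_ne_zero z hz1
  have hnorm : (liMap z).re ≤ ‖liMap z‖ := Complex.re_le_norm _
  have hn0 : 0 < ‖liMap z‖ := by linarith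
  set L := liMap z with hLdef
  set R₂ := Complex.digamma (L / 2) - Complex.log (L / 2) + 1 / (2 * (L / 2)) + 1 / (12 * (L / 2) ^ 2) -
    1 / (120 * (L / 2) ^ 4) with hR₂
  set R₂' := deriv Complex.digamma (L / 2) - 1 / (L / 2) - 1 / (2 * (L / 2) ^ 2) -
    1 / (6 * (L / 2) ^ 3) + 1 / (30 * (L / 2) ^ 5) with hR₂'
  have h1z : (1 - z) = L⁻¹ := by rw [hLdef, liMap, inv_inv]
  have hid : L ^ 3 * (Complex.digamma (L / 2) - Complex.log (L / 2)) +
      L ^ 4 / 4 * deriv Complex.digamma (L / 2) - L ^ 3 / 2 + L ^ 2 / 2 + 2 / 15 * (1 - z) =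
      L ^ 3 * R₂ + L ^ 4 / 4 * R₂' := by
    rw [h1z, hR₂, hR₂']
    field_simp
    ring
  rw [hid]
  have hb1 := norm_digamma_sub_stirling_four_le hw
  have hb2 := norm_deriv_digamma_sub_stirling_four_le hw
  rw [← hR₂] at hb1
  rw [← hR₂'] at hb2
  have hn2 : ‖L / 2‖ = ‖L‖ / 2 := by rw [norm_div]; simp
  have hre2 : (L / 2).re = L.re / 2 := Complex.div_ofNat_re _ _
  rw [hn2, hre2] at hb1 hb2
  have hπ := Real.pi_pos
  have hπ3 : 0 < Real.pi ^ 3 := by positivity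
  -- the two pieces
  have e1 : ‖L ^ 3 * R₂‖ ≤ 40 / Real.pi ^ 3 / (‖L‖ * L.re) := by
    rw [norm_mul, norm_pow]
    calc ‖L‖ ^ 3 * ‖R₂‖ ≤ ‖L‖ ^ 3 * (5 / (4 * Real.pi ^ 3) / ((‖L‖ / 2) ^ 4 * (L.re / 2))) := by
          gcongr
      _ = 40 / Real.pi ^ 3 / (‖L‖ * L.re) := by field_simp; ring
  have e2 : ‖L ^ 4 / 4 * R₂'‖ ≤ 120 / Real.pi ^ 3 / (‖L‖ * L.re) := by
    rw [norm_mul, norm_div, norm_pow]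
    simp only [RCLike.norm_ofNat]
    calc ‖L‖ ^ 4 / 4 * ‖R₂'‖ ≤ ‖L‖ ^ 4 / 4 * (15 / (2 * Real.pi ^ 3) / ((‖L‖ / 2) ^ 5 * (L.re / 2))) := by
          gcongr
      _ = 120 / Real.pi ^ 3 / (‖L‖ * L.re) := by field_simp; ring
  have e3 : 40 / Real.pi ^ 3 / (‖L‖ * L.re) + 120 / Real.pi ^ 3 / (‖L‖ * L.re) ≤ 640 / Real.pi ^ 3 := by
    rw [← add_div, div_le_iff₀ (by positivity)]
    have h4 : (1 : ℝ) / 4 ≤ ‖L‖ * L.re := by nlinarith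
    have h5 := mul_le_mul_of_nonneg_left h4 (le_of_lt (by positivity : (0 : ℝ) < 640 / Real.pi ^ 3))
    have h6 : (40 : ℝ) / Real.pi ^ 3 + 120 / Real.pi ^ 3 = 640 / Real.pi ^ 3 * (1 / 4) := by ring
    linarith
  exact (norm_add_le _ _).trans ((add_le_add e1 e2).trans e3)

/-- `Φ₂′` is holomorphic on the unit disc. [folklore] -/
private theorem differentiableOn_deriv_trendRem₂ :
    DifferentiableOn ℂ (fun z ↦ liMap z ^ 3 * (Complex.digamma (liMap z / 2) - Complex.log (liMap z / 2)) +
        liMap z ^ 4 / 4 * deriv Complex.digamma (liMap z / 2) - liMap z ^ 3 / 2 + liMap z ^ 2 / 2 +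
        2 / 15 * (1 - z)) (ball 0 1) := by
  intro z hz
  have hz' : ‖z‖ < 1 := by simpa using hz
  have hz1 := ne_one_of_norm_lt_one hz'
  have hL : DifferentiableAt ℂ liMap z := (hasDerivAt_liMap hz1).differentiableAt
  have hw : 0 < (liMap z / 2).re := re_liMap_half_pos hz'
  have hopen : IsOpen {w : ℂ | 0 < w.re} := isOpen_lt continuous_const Complex.continuous_re
  have hψan := Literature.Analysis.SpecialFunctions.Complex.differentiableOn_digamma.analyticOnNhd hopen
  have hψ0 : DifferentiableAt ℂ Complex.digamma (liMap z / 2) := (hψan _ hw).differentiableAt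
  have hψ : DifferentiableAt ℂ (fun z ↦ Complex.digamma (liMap z / 2)) z := hψ0.comp z (hL.div_const 2)
  have hψd0 : DifferentiableAt ℂ (deriv Complex.digamma) (liMap z / 2) :=
    (hψan.deriv _ hw).differentiableAt
  have hψd : DifferentiableAt ℂ (fun z ↦ deriv Complex.digamma (liMap z / 2)) z := by
    have h := DifferentiableAt.comp z hψd0 (hL.div_const 2)
    simpa [Function.comp_def] using h
  have hlog : DifferentiableAt ℂ (fun z ↦ Complex.log (liMap z / 2)) z :=
    (hL.div_const 2).clog (Complex.mem_slitPlane_iff.2 (Or.inl hw))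
  exact ((((((hL.pow 3).mul (hψ.sub hlog)).add (((hL.pow 4).div_const 4).mul hψd)).sub
    ((hL.pow 3).div_const 2)).add ((hL.pow 2).div_const 2)).add
      ((differentiableAt_const _).mul ((differentiableAt_const _).sub differentiableAt_id))).differentiableWithinAt

/-- **RH-FREE. Decay of the error in the trend law** (towards Voros's `o(n^{−N})`): for `n ≥ 2`,

  `| (λ_n − S_n) − ( (n/2)(H_n − 1 − log 2π) + 1/2 ) | ≤ (640/π³)/(n − 1)`.

In particular `λ_n − S_n − (n/2)(H_n − 1 − log 2π) → 1/2`, i.e. the constant `3/4` of Voros's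
`S̄_n = ½n(log n − 1 + γ − log 2π) + 3/4 + o(1)` (as `(n/2)(H_n − log n − γ) → 1/4`).
-- TODO(general form): Voros 2006 (4.6) has the error `o(n^{−N})` for every `N` (all Stirling terms).
[cite: Voros2006, §4 eq. (4.6)] -/
theorem abs_keiperLiCoeff_sub_osc_sub_trend_le_div {n : ℕ} (hn : 2 ≤ n) :
    |keiperLiCoeff n - ∑ j ∈ Finset.range n, (n.choose (j + 1) : ℝ) *
        (Xiao2020.zetaOneLogDerivCoeff j).re -
      (n / 2 * ((harmonic n : ℝ) - 1 - Real.log (2 * Real.pi)) + 1 / 2)| ≤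
      640 / Real.pi ^ 3 / (n - 1 : ℝ) := by
  obtain ⟨m, rfl⟩ : ∃ m, n = m + 1 := ⟨n - 1, by omega⟩
  have hm1 : 1 ≤ m := by omega
  have hπ := Real.pi_pos
  have hπ3 : 0 < Real.pi ^ 3 := by positivity
  have hm0 : (0 : ℝ) < m := by exact_mod_cast hm1
  have hcast : ((m + 1 : ℕ) : ℝ) - 1 = m := by push_cast; ring
  rw [hcast]
  rcases le_or_gt m 2 with hm2 | hm3
  · -- `n ∈ {2, 3}`: the bound `2/π` is already smaller
    have h0 := abs_keiperLiCoeff_sub_osc_sub_trend_le (n := m + 1) (by omega)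
    have hm2' : (m : ℝ) ≤ 2 := by exact_mod_cast hm2
    have h1 : 2 / Real.pi * m ≤ 4 / Real.pi := by
      have := mul_le_mul_of_nonneg_left hm2' (le_of_lt (by positivity : (0 : ℝ) < 2 / Real.pi))
      have e : 2 / Real.pi * 2 = 4 / Real.pi := by ring
      linarith
    have h2 : 4 / Real.pi ≤ 640 / Real.pi ^ 3 := by
      rw [div_le_div_iff₀ hπ hπ3]
      have hπ2 : Real.pi ^ 2 ≤ 16 := by nlinarith [Real.pi_le_four, hπ.le]
      have h5 : Real.pi ^ 3 ≤ 16 * Real.pi := by nlinarith [hπ2, hπ.le]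
      linarith
    have h3 : 2 / Real.pi ≤ 640 / Real.pi ^ 3 / m := by
      rw [le_div_iff₀ hm0]; linarith
    exact h0.trans h3
  · -- `m ≥ 3`: one derivative and Cauchy's estimate for `Φ₂′`
    obtain ⟨k, rfl⟩ : ∃ k, m = k + 3 := ⟨m - 3, by omega⟩
    rw [keiperLiCoeff_sub_osc_sub_trend_eq, if_neg (by omega), sub_zero]
    -- `Φ = (1−z)²/15 + Φ₂` near `0`
    have hev : (fun z ↦ liMap z ^ 2 / 2 * (Complex.digamma (liMap z / 2) -
        Complex.log (liMap z / 2) + (liMap z)⁻¹ + (3 * liMap z ^ 2)⁻¹)) =ᶠ[𝓝 (0 : ℂ)]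
        fun z ↦ (1 - z) ^ 2 / 15 + (liMap z ^ 2 / 2 * (Complex.digamma (liMap z / 2) -
          Complex.log (liMap z / 2)) + liMap z / 2 + 1 / 6 - (1 - z) ^ 2 / 15) := by
      filter_upwards [eventually_ne_nhds (zero_ne_one : (0 : ℂ) ≠ 1)] with z hz
      have hL0 := liMap_ne_zero z hz
      field_simp
      ring
    have hdiff : DifferentiableOn ℂ (fun z ↦ liMap z ^ 2 / 2 * (Complex.digamma (liMap z / 2) -
        Complex.log (liMap z / 2)) + liMap z / 2 + 1 / 6 - (1 - z) ^ 2 / 15) (ball 0 1) :=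
      fun z hz ↦ (hasDerivAt_trendRem₂ (by simpa using hz)).differentiableAt.differentiableWithinAt
    have hΦ₂ : ContDiffAt ℂ (k + 3) (fun z ↦ liMap z ^ 2 / 2 * (Complex.digamma (liMap z / 2) -
        Complex.log (liMap z / 2)) + liMap z / 2 + 1 / 6 - (1 - z) ^ 2 / 15) 0 :=
      (hdiff.analyticAt (ball_mem_nhds (0 : ℂ) one_pos)).contDiffAt
    have hP : ContDiffAt ℂ (k + 3) (fun z : ℂ ↦ (1 - z) ^ 2 / 15) 0 :=
      (((contDiff_const.sub contDiff_id).pow 2).div_const 15).contDiffAt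
    have hder : deriv (fun z ↦ liMap z ^ 2 / 2 * (Complex.digamma (liMap z / 2) -
        Complex.log (liMap z / 2)) + liMap z / 2 + 1 / 6 - (1 - z) ^ 2 / 15) =ᶠ[𝓝 (0 : ℂ)]
        fun z ↦ liMap z ^ 3 * (Complex.digamma (liMap z / 2) - Complex.log (liMap z / 2)) +
          liMap z ^ 4 / 4 * deriv Complex.digamma (liMap z / 2) - liMap z ^ 3 / 2 + liMap z ^ 2 / 2 +
          2 / 15 * (1 - z) := by
      filter_upwards [Metric.ball_mem_nhds (0 : ℂ) one_pos] with z hz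
      exact (hasDerivAt_trendRem₂ (by simpa using hz)).deriv
    rw [hev.iteratedDeriv_eq, iteratedDeriv_fun_add hP hΦ₂, iteratedDeriv_poly_eq_zero, zero_add,
      show k + 3 = (k + 2) + 1 by ring, iteratedDeriv_succ', hder.iteratedDeriv_eq]
    set Dk := iteratedDeriv (k + 2) (fun z ↦ liMap z ^ 3 * (Complex.digamma (liMap z / 2) -
      Complex.log (liMap z / 2)) + liMap z ^ 4 / 4 * deriv Complex.digamma (liMap z / 2) -
        liMap z ^ 3 / 2 + liMap z ^ 2 / 2 + 2 / 15 * (1 - z)) 0 with hDk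
    have hC : ‖Dk‖ ≤ (k + 2)! * (640 / Real.pi ^ 3) :=
      norm_iteratedDeriv_le_of_forall_mem_unitBall differentiableOn_deriv_trendRem₂
        (fun z hz ↦ norm_deriv_trendRem₂_le (by simpa using hz)) (k + 2)
    have hfpos : (0 : ℝ) < (k + 2 + 1)! := by exact_mod_cast Nat.factorial_pos _
    calc |(Dk / ((k + 2 + 1)! : ℂ)).re| ≤ ‖Dk / ((k + 2 + 1)! : ℂ)‖ := Complex.abs_re_le_norm _
      _ = ‖Dk‖ / (k + 2 + 1)! := by rw [norm_div, Complex.norm_natCast]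
      _ ≤ (k + 2)! * (640 / Real.pi ^ 3) / (k + 2 + 1)! := by gcongr
      _ = 640 / Real.pi ^ 3 / ((k + 3 : ℕ) : ℝ) := by
          rw [Nat.factorial_succ (k + 2)]; push_cast; field_simp; ring

/-- **RH-FREE. The constant term of the trend**: `λ_n − S_n − (n/2)(H_n − 1 − log 2π) → 1/2`.
[cite: Voros2006, §4 eq. (4.6)] -/
theorem tendsto_keiperLiCoeff_sub_osc_sub_trend :
    Tendsto (fun n : ℕ ↦ keiperLiCoeff n - ∑ j ∈ Finset.range n, (n.choose (j + 1) : ℝ) *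
        (Xiao2020.zetaOneLogDerivCoeff j).re - n / 2 * ((harmonic n : ℝ) - 1 - Real.log (2 * Real.pi)))
      atTop (𝓝 (1 / 2)) := by
  rw [Metric.tendsto_atTop]
  intro ε hε
  obtain ⟨N, hN⟩ := exists_nat_gt (640 / Real.pi ^ 3 / ε + 1)
  refine ⟨max N 2, fun n hn ↦ ?_⟩
  have hn2 : 2 ≤ n := le_of_max_le_right hn
  have hnN : N ≤ n := le_of_max_le_left hn
  have h := abs_keiperLiCoeff_sub_osc_sub_trend_le_div hn2
  rw [Real.dist_eq]
  have hn1 : (0 : ℝ) < n - 1 := by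
    have : (2 : ℝ) ≤ n := by exact_mod_cast hn2
    linarith
  have hlt : 640 / Real.pi ^ 3 / ((n : ℝ) - 1) < ε := by
    rw [div_lt_iff₀ hn1]
    have hNn : (N : ℝ) ≤ n := by exact_mod_cast hnN
    have h1 : 640 / Real.pi ^ 3 / ε < n - 1 := by linarith
    have h2 := (div_lt_iff₀ hε).1 h1
    linarith
  refine lt_of_le_of_lt ?_ hlt
  refine le_trans (le_of_eq ?_) h
  congr 1
  ring

end Literature.NumberTheory.LFunctions
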